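import Literature.MathematicalPhysics.QuantumFieldTheory.Balaban1983to89.B9Eq342GreenPrimeSupBoundDecayCosh
import Literature.MathematicalPhysics.QuantumFieldTheory.Balaban1983to89.B9Eq349ConjugatedGreenBlockDecay

/-!
# `Balaban1983to89.B9Eq342GreenPrimeSupBoundDecayWindow` — T. Bałaban, *Propagators for lattice gauge theories in a background field*, Commun. Math. Phys.
# **99** (1985) 389–434 [Balaban1985BackgroundPropagators] Thm 3.1 (3.42) p. 397 with Thm 3.11 p. 416 and (3.49) p. 399: **THE DECAY ROW OF (3.42) AND ITS
# `L^∞ → L^∞` ROW SUM FOR PRINT's `G′(U)`, UNIFORMLY ON THE DIAGONAL WINDOW — (D-E) INHABITED BY NAME by ne9-leaf-01 g84's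
# `B9Eq349ConjugatedGreenBlockDecay.exists_block_decay_Gp` (ONE `C ≥ 0` BEFORE `∀ U` of the window; `C_E = Ce^{r}`, `κ = r`), composed with the junction
# `B9Eq342GreenPrimeSupBoundDecayCosh` ((W)+(D-FS) inhabited): `∃ C ≥ 0, ∀ U ∈ window, ∀ f, ‖(G′(U)f)(x₀)‖ ≤ (B₁(Ce^r) + B₂(Ce^r))·K_d(κ′∕2)·sup|f|` — the
# ONLY displayed analytic letters left are the chain's block-local penalty (D-P) (ne9-leaf-03's `B9Eq324PenaltyBlockLocal`, staged), the contraction (T) of the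
# transporters in the fibre norm and the one-block masses `‖P_vf‖ ≤ √μF`** — storey (D) of the NE9 owner's SUP-NORM PROGRAMME (plan v10 §5) at its (D-E) supplier

statement-level skeleton of published theorems with citation tags; proofs where landed; nothing here is a claim about the Yang–Mills mass gap

CITATION HEADER (lean-in-tree rule).  Audit cell `pub-balaban`, sub-cell `t4`, BINDER row NE9; filed by the row OWNER lineage `b2b-balaban-t4-ne9-p1` (gen 90), typed
the hour the `B7Prop4Flat` olean cone healed (ops-buildfix no-op re-land p372431; `…ConjugatedGreenBlockDecay` serving again).  Sources as quoted verbatim in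
`B9Eq342GreenPrimeSupBoundDecay` and `B9Eq349ConjugatedGreenBlockDecay` ([Balaban1985BackgroundPropagators] p. 397 Thm 3.1 (3.42), p. 416 Thm 3.11 *«uniformly
bounded from below … decay exponentially»*, (3.49) p. 399).  NOTHING printed is used as a hypothesis; `[cite: …]` tags are TEXT LOCATIONS; the statement is a
`[folklore]` composition BY NAME (ABSOLUTE RULE).

WHAT IS PROVED (sorry-free; 0 `def`).  Letters of `exists_block_decay_Gp` VERBATIM (fibre-norm equivalence `M_φ, M_φ′`, `0 < η`, `ε_U`, diagonal `c₁ = L^d c₀`,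
`0 < a′`, `ηL = 1`; scalar window `γ ≤ c_Δ(…)`, radius windows for `r, ℓ, ℓ′, β`, `3(1+a′)β² ≤ γ∕4`, `1 ≤ L`, `1 ≤ m_i`) ⟹ **`exists_rowSum_bound_window`**:
`∃ C ≥ 0` such that for EVERY background `U` of the window (`U(b) ∈ U1`, `‖U(b) − 1‖ ≤ ε_U`, mutually adjoint transports `hRS`) whose transporters contract
the fibre norm ((T) `hR`, `hS`), every (K1) block family `P`, every rate `0 ≤ a` with `0 < λ = 1 − 2dη⁻²(cosh a − 1)` and `0 < κ′ ≤ r`, `κ′ < aL`, every block-local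
penalty letter (D-P) `p₂`, every `k`, every `f` with `‖f(x)‖ ≤ F`, `‖P_vf‖ ≤ √μF` and every site `x₀`:
`‖(G′(U)f)(x₀)‖ ≤ ((1 + p₂(Ce^r)√μ)·2e^{a(L−1)}·Σ_{l<k}λ^{−(l+1)} + √(λ^{−k}∕c₀)·√(2e^{a(L−1)}K_d(aL−κ′))·(Ce^r)·√μ)·K_d(κ′∕2)·F` — `G′(U)` read at the
positivity witness `laplacePrimeA_pos_of_hRS` of the chain (any other witness gives the same operator by proof irrelevance).
HONEST SCOPE.  Composition; (D-P), (T) and the masses stay displayed; constants crude; VALUE row only (no height-free ∇-row, no Hölder norms); ONE STEP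
(`fineP L m`), not the tower.  NOT summit progress (cell pub-balaban: NE9 NOT PRINTED ∕ NOT PROVED; «NE9 ⇐ the named binders»; row WALLED ON A MODEL (O-NE9-1;
#5 UNRULED); spine PROVED 0∕9; rung (B)+1 finite T⁴ — NOT infinite volume, NOT mass gap, NOT BetaPertH, NOT Clay).  HONEST DEPENDENCY (cell line): continuum YM
on T⁴ ⇐ BetaPertH ∧ nine spine estimates (0/9 proved); BetaPertH ⇐ (D1) ∧ (D4) ∧ CAP+tail; G-an2-4 gates asym, D1 and NE2/3/4.  NEW file importing
`B9Eq342GreenPrimeSupBoundDecayCosh` + `B9Eq349ConjugatedGreenBlockDecay`; nothing modified.  Net new unproved facts: 0.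
-/

noncomputable section

open scoped InnerProductSpace ComplexConjugate BigOperators

namespace Literature.MathematicalPhysics.QuantumFieldTheory.Balaban1983to89.B9Eq342GreenPrimeSupBoundDecayWindow

open B4Sect5Torus (TSite tdist)
open B4Sect5Proof (latticeConst)
open B9SectCLatticeCarrier (Bond shift unshift)
open B9Eq319QprimeTorus (fineP blockCoord)
open B9Eq311L2Pairing (WL2)
open B11Eq103H1Complex (SiteL2K covLaplaceSiteK)
open B7Prop1Explicit (U1)
open B9Eq310HessianOperator (adTransportW)
open B9Eq3119DeltaPiCarrier (laplacePrimeA GpOfU)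
open B9Thm311DeltaPrimeA (laplacePrimeA_pos_of_hRS)
open B9Eq349ConjugatedGreenBlockDecay (exists_block_decay_Gp)
open B9Eq342GreenPrimeSupBoundDecayCosh (norm_GpOfU_apply_le_rowSum_cosh)

variable {d : ℕ} {L : ℕ} [NeZero L] {m : Fin d → ℕ} {𝔸 : Type*} [NormedRing 𝔸] [NormedAlgebra ℂ 𝔸] [NormOneClass 𝔸]
  {W : Type*} [NormedAddCommGroup W] [InnerProductSpace ℂ W] [FiniteDimensional ℂ W] {φ : W ≃ₗ[ℂ] 𝔸} {Mφ Mφ' : ℝ}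
  (hφ : ∀ w, ‖φ w‖ ≤ Mφ * ‖w‖) (hφ' : ∀ X, ‖φ.symm X‖ ≤ Mφ' * ‖X‖) (hMφ : 0 ≤ Mφ) (hMφ' : 0 ≤ Mφ')
  {c₀ : ℝ} [Fact (0 < c₀)] {η : ℝ} (hη : 0 < η) {εU : ℝ} (hεU : 0 ≤ εU)
  {c₁ : ℝ} [Fact (0 < c₁)] (hc : c₁ = (L : ℝ) ^ d * c₀) {a' : ℝ} (ha' : 0 < a') (hηL : η * L = 1)

include hφ hφ' hMφ hMφ' hη hεU hc ha' hηL in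
/-- **THE DECAY ROW OF (3.42) + ITS `L^∞ → L^∞` ROW SUM FOR `G′(U)`, UNIFORMLY ON THE DIAGONAL WINDOW** (one `C ≥ 0` before `∀ U`): under the letters of
`exists_block_decay_Gp` verbatim, for every background of the window with contractive, mutually adjoint transporters, every block family, every admissible
rate `a` and `0 < κ′ ≤ r`, `κ′ < aL`, every block-local penalty constant `p₂` ((D-P) displayed) and every datum with `‖f(x)‖ ≤ F`, `‖P_vf‖ ≤ √μF`:
`‖(G′(U)f)(x₀)‖ ≤ (B₁(Ce^r) + B₂(Ce^r))·K_d(κ′∕2)·F` at every site `x₀` — print's «|(G′(U)λ)(x)| ≤ B₀e^{−δ₀d(y,y′)}|λ|» summed over the source blocks, for the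
chain's site propagator, with the `L²` block decay (D-E) now a TREE THEOREM inside the statement.
[cite: Balaban1985BackgroundPropagators, Thm 3.1 (3.42) p.397, Thm 3.11 p.416, (3.49) p.399] -/
theorem exists_rowSum_bound_window {γ β r : ℝ} (hγ : 0 < γ) (hβ : 0 ≤ β) (hr : 0 ≤ r)
    (hγc : γ ≤ 1 / (2 + 2 / a') -
        (Real.sqrt d * (‖((η : ℂ))⁻¹‖ * (2 * Mφ * Mφ' * εU)) + (Real.sqrt d * (‖((η : ℂ))⁻¹‖ * (2 * Mφ * Mφ' * εU))) ^ 2 +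
          a' * (((1 + 2 * Mφ * Mφ' * εU) ^ (d * (L - 1)) - 1)) * (2 + ((1 + 2 * Mφ * Mφ' * εU) ^ (d * (L - 1)) - 1))))
    {ℓ ℓ' : ℝ} (hℓ : 1 ≤ ℓ) (hℓ' : 1 ≤ ℓ') (hwin : r * ℓ * η ≤ 1) (hwin' : r * ℓ' ≤ 1)
    (hβD : 2 * r * ℓ * (Mφ * Mφ') * Real.sqrt d ≤ β) (hβQ : 2 * r * ℓ' * (1 + 2 * Mφ * Mφ' * εU) ^ (d * (L - 1)) ≤ β)
    (small : 3 * (1 + a') * β ^ 2 ≤ γ / 4) (hL : 1 ≤ L) (hm : ∀ i, 1 ≤ m i) :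
    ∃ C : ℝ, 0 ≤ C ∧ ∀ (U : Bond d (fineP L m) → 𝔸ˣ) (hU : ∀ b, U b ∈ U1 𝔸) (hUε : ∀ b, ‖(U b : 𝔸) - 1‖ ≤ εU)
      (hRS : ∀ (b : Bond d (fineP L m)) (v u : W), ⟪adTransportW φ U b v, u⟫_ℂ = ⟪v, adTransportW φ (fun b => (U b)⁻¹) b u⟫_ℂ)
      (_hR : ∀ b w, ‖adTransportW φ U b w‖ ≤ ‖w‖) (_hS : ∀ b w, ‖adTransportW φ (fun b => (U b)⁻¹) b w‖ ≤ ‖w‖)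
      (PS : TSite d m → SiteL2K ℂ d (fineP L m) c₀ W →L[ℂ] SiteL2K ℂ d (fineP L m) c₀ W)
      (_hPS : ∀ (y : TSite d m) (g : SiteL2K ℂ d (fineP L m) c₀ W) (x : TSite d (fineP L m)),
        WL2.equiv ℂ (fun _ : TSite d (fineP L m) => c₀) W (PS y g) x =
          if blockCoord L m x = y then WL2.equiv ℂ (fun _ : TSite d (fineP L m) => c₀) W g x else 0)
      (p₂ κ' a : ℝ) (_hp₂ : 0 ≤ p₂) (_ha : 0 ≤ a) (_hlam : 0 < 1 - 2 * d * (η⁻¹) ^ 2 * (Real.cosh a - 1))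
      (_hκ' : 0 < κ') (_hκ : κ' ≤ r) (_hκ₁ : κ' < a * L)
      (_hP : ∀ (v : SiteL2K ℂ d (fineP L m) c₀ W) (x : TSite d (fineP L m)),
        ‖WL2.equiv ℂ _ W (laplacePrimeA L m φ η U a' (c₁ := c₁) v -
          covLaplaceSiteK ((η : ℂ))⁻¹ (adTransportW φ U) (adTransportW φ fun b => (U b)⁻¹) v) x‖ ≤ p₂ * ‖PS (blockCoord L m x) v‖)
      (x₀ : TSite d (fineP L m)) (k : ℕ) (f : SiteL2K ℂ d (fineP L m) c₀ W) (F μ : ℝ) (_hF : ∀ y, ‖WL2.equiv ℂ _ W f y‖ ≤ F)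
      (_hμ : ∀ v, ‖PS v f‖ ≤ Real.sqrt μ * F),
      ‖WL2.equiv ℂ _ W (GpOfU L m φ η U a' (c₁ := c₁)
          (fun x hx => laplacePrimeA_pos_of_hRS L m φ η U a' hη.ne' ha' hRS x hx) f) x₀‖ ≤
        ((1 + p₂ * (C * Real.exp r) * Real.sqrt μ) * (Real.exp (a * ((L : ℝ) - 1)) * 2) *
              (∑ l ∈ Finset.range k, ((1 - 2 * d * (η⁻¹) ^ 2 * (Real.cosh a - 1)) ^ (l + 1))⁻¹) +
          Real.sqrt (((1 - 2 * d * (η⁻¹) ^ 2 * (Real.cosh a - 1)) ^ k)⁻¹ / c₀) *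
            Real.sqrt ((Real.exp (a * ((L : ℝ) - 1)) * 2) * latticeConst d (a * L - κ')) * (C * Real.exp r) * Real.sqrt μ) *
          latticeConst d (κ' / 2) * F := by
  obtain ⟨C, hC0, H⟩ := exists_block_decay_Gp hφ hφ' hMφ hMφ' hη hεU hc ha' hηL hγ hβ hr hγc hℓ hℓ' hwin hwin' hβD hβQ small hL hm
  refine ⟨C, hC0, fun U hU hUε hRS hR hS PS hPS p₂ κ' a hp₂ ha hlam hκ' hκ hκ₁ hP x₀ k f F μ hF hμ => ?_⟩
  have hdec : ∀ v y : TSite d m, ‖PS y ∘L LinearMap.toContinuousLinearMap (GpOfU L m φ η U a' (c₁ := c₁)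
      (fun x hx => laplacePrimeA_pos_of_hRS L m φ η U a' hη.ne' ha' hRS x hx)) ∘L PS v‖ ≤
        C * Real.exp r * Real.exp (-(r * tdist m v y)) := fun v y => H U hU hUε hRS PS hPS v y
  exact norm_GpOfU_apply_le_rowSum_cosh L m φ η U a' _ (c₁ := c₁) hm hR hS hPS hp₂ (mul_nonneg hC0 (Real.exp_pos _).le) ha hlam hκ' hκ hκ₁
    hP hdec x₀ k f hF hμ

end Literature.MathematicalPhysics.QuantumFieldTheory.Balaban1983to89.B9Eq342GreenPrimeSupBoundDecayWindow

end
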